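import Mathlib
import HarnessLib
import Summits.HubbardSuperconductivity.HubbardSuperconductivity.Theorems.KLProgrammeKLRegimeEnginePairTransferDLineEdgeSplit3DoorSharpZS
import Summits.HubbardSuperconductivity.HubbardSuperconductivity.Theorems.KLProgrammeKLRegimeEnginePairTransferDLineEdgeSplit3DoorSharpTC

/-!
# Route `KLProgramme` — ENGINE item stmt-HubbardSuperconductivity-20437 `KLRegimeEngineV17F2`, class-#5 STEP (X).3 budget side, THE PINNED PAIR «88b»:
# the ROOM-slot readings of the sharp rows AT ZERO TRANSFER (the points `x = y` of the direct row and `x + y = Q_m` of the crossed row, where the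
# forward-window slot lemmas' `0 < r` is not available) (cell gate-hubbard-kl, seat hubbard-kl-k3c2-p2 g22)

k3c1-p1 g17 («88b», KL STATUS 2026-08-28 23:56Z): «the x = y / x+y = Qm points of the forward rows (norm 0: slots lemma wants `0 < r` — a zero-transfer twin)».
Here they are, for the `S` rows (`klmsRowBoundS`, sharp zero-sound piece) and the `TC` rows (`klmsRowBoundTC`, + path transfer constant + split count):
at transfer `δ = 0` the transfer monomial is absent (`pinned_row_le_slots_zeroS/TC`); at `δ = |s| = 2π/β` (crossed row at `x + y = Q_m`) it is thermal
(`pinned_row_le_slots_shift_zeroS/TC`, booked with `(π/β)/Λₙ₊₁ ≤ 4·4^{−(n_β−n)}`).  Pure real arithmetic over `pinned_rowBound_readingS/TC`;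
nothing about the model is asserted; nothing asserts (X).3, (c), K3 or superconductivity.
-/

noncomputable section

namespace Summit.HubbardSuperconductivity.HubbardSuperconductivity.Theorems.KLRegimeSplit

set_option linter.dupNamespace false -- summit = problem name (single-conjunct summit), D-0017

open Real Set Finset Complex Literature.MathematicalPhysics.QuantumLattice
open Literature.Probability.LatticeModels hiding torusSupNorm
open Summit.HubbardSuperconductivity.HubbardSuperconductivity.Theorems.KLProgrammeLegKernels

variable {L M : ℕ} [NeZero L] [NeZero M] (β : ℝ)

/-! ## §1 The `S` rows at zero transfer -/

omit [NeZero M] in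
/-- **The `S` pinned row at ZERO transfer** (`δ = 0`: direct row at `x = y`): `2·(Λₙ−Λₙ₊₁)·Row^S_{n+2}(0) ≤ (3/π)·ZS⋆·klE0·(4ⁿ⁺¹)⁻¹ + (12/π)·TH⋆·(4^{n_β−n})⁻¹ + 2·LAT⋆/L`. -/
theorem pinned_row_le_slots_zeroS {d A G A₀ La : ℝ} (hdA : 0 < d - 4 * A) (hA : 0 ≤ A) (hA0 : 0 ≤ A₀) (hLa : 0 ≤ La)
    (hβ : klBetaMin ≤ β) {n : ℕ} (hn : n ≤ nScales β) :
    2 * ((klScale klE0 n - klScale klE0 (n + 1)) * klmsRowBoundS d A G A₀ La β n (n + 2) 0 L) ≤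
      3 / π * (64 / Real.pi * 8 *
              (Real.pi * Real.sqrt 2 / (d - 4 * A) * (2 * La + 2 * A₀ * (2 / (1 / 10))) / (d - 4 * A) +
                2 * A₀ * (1 / (d - 4 * A) ^ 2 + Real.pi * Real.sqrt 2 * (2 + 4 * A) / (d - 4 * A) ^ 3))) *
          klE0 * ((4 : ℝ) ^ (n + 1))⁻¹ +
        12 / π * (393216 / Real.pi * (64 * 16 + (2 * (448 / 3 * Real.exp 2) + 8) + 64) * (2 * A₀ * (Real.pi * Real.sqrt 2 / (d - 4 * A)))) *
          ((4 : ℝ) ^ (nScales β - n))⁻¹ +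
        2 * ((96 * (512 * La / klScale klE0 (n + 1) +
            32 * A₀ * G * ((9 * (2 * (448 / 3 * Real.exp 2) + 8) + 4 * 8) + (65 * (8 * (16 : ℝ)) + 17408 / 3 * 1)) /
              klScale klE0 (n + 1) ^ 2)) / L) := by
  have hπ := Real.pi_pos
  have hβ0 : 0 < β := lt_of_lt_of_le (by norm_num [klBetaMin]) hβ
  have hΛ1 := klth_klScale_pos (n + 1)
  rw [pinned_rowBound_readingS]
  set ZS : ℝ := 64 / Real.pi * 8 *
      (Real.pi * Real.sqrt 2 / (d - 4 * A) * (2 * La + 2 * A₀ * (2 / (1 / 10))) / (d - 4 * A) +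
                2 * A₀ * (1 / (d - 4 * A) ^ 2 + Real.pi * Real.sqrt 2 * (2 + 4 * A) / (d - 4 * A) ^ 3)) with hZS
  set TH : ℝ := (393216 / Real.pi * (64 * 16 + (2 * (448 / 3 * Real.exp 2) + 8) + 64) * (2 * A₀ * (Real.pi * Real.sqrt 2 / (d - 4 * A)))) with hTH
  set LAT : ℝ := (96 * (512 * La / klScale klE0 (n + 1) +
            32 * A₀ * G * ((9 * (2 * (448 / 3 * Real.exp 2) + 8) + 4 * 8) + (65 * (8 * (16 : ℝ)) + 17408 / 3 * 1)) /
              klScale klE0 (n + 1) ^ 2)) with hLAT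
  obtain ⟨hZS0, hTH0⟩ : 0 ≤ ZS ∧ 0 ≤ TH := ⟨by rw [hZS]; positivity, by rw [hTH]; positivity⟩
  clear_value ZS TH LAT
  have hΛeq : klScale klE0 (n + 1) = klE0 * ((4 : ℝ) ^ (n + 1))⁻¹ := rfl
  have hth := klmsRoom_thermal_le hβ hn
  set q : ℝ := ((4 : ℝ) ^ (nScales β - n))⁻¹ with hq
  set p : ℝ := (Real.pi / β) / klScale klE0 (n + 1) with hp
  have hp0 : 0 ≤ p := by rw [hp]; positivity
  have hth' : p ≤ 4 * q := hth
  have hzero : (|(0 : ℝ)| + 0) / klScale klE0 (n + 1) = 0 := by rw [abs_zero, add_zero, zero_div]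
  rw [hzero]
  simp only [mul_zero, add_zero]
  have h1 : 3 / (2 * π) * (ZS * klScale klE0 (n + 1)) = 1 / 2 * (3 / π * ZS * klE0 * ((4 : ℝ) ^ (n + 1))⁻¹) := by rw [hΛeq]; ring
  have h2 : 3 / (2 * π) * (TH * p) ≤ 1 / 2 * (12 / π * TH * q) := by
    have := mul_le_mul_of_nonneg_left hth' (by positivity : 0 ≤ 3 / (2 * π) * TH)
    calc 3 / (2 * π) * (TH * p) = 3 / (2 * π) * TH * p := by ring
      _ ≤ 3 / (2 * π) * TH * (4 * q) := this
      _ = 1 / 2 * (12 / π * TH * q) := by ring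
  have hsplit : 3 / (2 * π) * (ZS * klScale klE0 (n + 1) + TH * p) = 3 / (2 * π) * (ZS * klScale klE0 (n + 1)) + 3 / (2 * π) * (TH * p) := by ring
  rw [hsplit, h1]
  linarith

omit [NeZero M] in
/-- **The `S` shifted pinned row at ZERO spatial transfer** (`δ = |s| = 2π/β`: crossed row at `x + y = Q_m`; the bosonic shift is thermal):
`2·(Λₙ−Λₙ₊₁)·Row^S_{n+2}(|s|) ≤ (3/π)·ZS⋆·klE0·(4ⁿ⁺¹)⁻¹ + (12/π)·(TH⋆ + 2·TR⋆)·(4^{n_β−n})⁻¹ + 2·LAT⋆/L`. -/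
theorem pinned_row_le_slots_shift_zeroS {d A G A₀ La : ℝ} (hdA : 0 < d - 4 * A) (hA : 0 ≤ A) (hA0 : 0 ≤ A₀) (hLa : 0 ≤ La)
    (hβ : klBetaMin ≤ β) {n : ℕ} (hn : n ≤ nScales β) {s : ℝ} (hs : |s| = 2 * π / β) :
    2 * ((klScale klE0 n - klScale klE0 (n + 1)) * klmsRowBoundS d A G A₀ La β n (n + 2) |s| L) ≤
      3 / π * (64 / Real.pi * 8 *
              (Real.pi * Real.sqrt 2 / (d - 4 * A) * (2 * La + 2 * A₀ * (2 / (1 / 10))) / (d - 4 * A) +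
                2 * A₀ * (1 / (d - 4 * A) ^ 2 + Real.pi * Real.sqrt 2 * (2 + 4 * A) / (d - 4 * A) ^ 3))) *
          klE0 * ((4 : ℝ) ^ (n + 1))⁻¹ +
        12 / π * ((393216 / Real.pi * (64 * 16 + (2 * (448 / 3 * Real.exp 2) + 8) + 64) * (2 * A₀ * (Real.pi * Real.sqrt 2 / (d - 4 * A)))) +
            2 * (256 / Real.pi * 8 * (2 * A₀ * (Real.pi * Real.sqrt 2 / (d - 4 * A))) * (65 * (8 * (16 : ℝ)) + 17408 / 3 * 1))) *
          ((4 : ℝ) ^ (nScales β - n))⁻¹ +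
        2 * ((96 * (512 * La / klScale klE0 (n + 1) +
            32 * A₀ * G * ((9 * (2 * (448 / 3 * Real.exp 2) + 8) + 4 * 8) + (65 * (8 * (16 : ℝ)) + 17408 / 3 * 1)) /
              klScale klE0 (n + 1) ^ 2)) / L) := by
  have hπ := Real.pi_pos
  have hβ0 : 0 < β := lt_of_lt_of_le (by norm_num [klBetaMin]) hβ
  have hΛ1 := klth_klScale_pos (n + 1)
  rw [pinned_rowBound_readingS, hs]
  set ZS : ℝ := 64 / Real.pi * 8 *
      (Real.pi * Real.sqrt 2 / (d - 4 * A) * (2 * La + 2 * A₀ * (2 / (1 / 10))) / (d - 4 * A) +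
                2 * A₀ * (1 / (d - 4 * A) ^ 2 + Real.pi * Real.sqrt 2 * (2 + 4 * A) / (d - 4 * A) ^ 3)) with hZS
  set TH : ℝ := (393216 / Real.pi * (64 * 16 + (2 * (448 / 3 * Real.exp 2) + 8) + 64) * (2 * A₀ * (Real.pi * Real.sqrt 2 / (d - 4 * A)))) with hTH
  set TR : ℝ := (256 / Real.pi * 8 * (2 * A₀ * (Real.pi * Real.sqrt 2 / (d - 4 * A))) * (65 * (8 * (16 : ℝ)) + 17408 / 3 * 1)) with hTR
  set LAT : ℝ := (96 * (512 * La / klScale klE0 (n + 1) +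
            32 * A₀ * G * ((9 * (2 * (448 / 3 * Real.exp 2) + 8) + 4 * 8) + (65 * (8 * (16 : ℝ)) + 17408 / 3 * 1)) /
              klScale klE0 (n + 1) ^ 2)) with hLAT
  obtain ⟨hZS0, hTH0, hTR0⟩ : 0 ≤ ZS ∧ 0 ≤ TH ∧ 0 ≤ TR := ⟨by rw [hZS]; positivity, by rw [hTH]; positivity, by rw [hTR]; positivity⟩
  clear_value ZS TH TR LAT
  have hΛeq : klScale klE0 (n + 1) = klE0 * ((4 : ℝ) ^ (n + 1))⁻¹ := rfl
  have hth := klmsRoom_thermal_le hβ hn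
  set q : ℝ := ((4 : ℝ) ^ (nScales β - n))⁻¹ with hq
  set p : ℝ := (Real.pi / β) / klScale klE0 (n + 1) with hp
  have hp0 : 0 ≤ p := by rw [hp]; positivity
  have hth' : p ≤ 4 * q := hth
  have hshift : (|(0 : ℝ)| + 2 * π / β) / klScale klE0 (n + 1) = 2 * p := by
    rw [abs_zero, zero_add, hp]; ring
  rw [hshift]
  have h1 : 3 / (2 * π) * (ZS * klScale klE0 (n + 1)) = 1 / 2 * (3 / π * ZS * klE0 * ((4 : ℝ) ^ (n + 1))⁻¹) := by rw [hΛeq]; ring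
  have h2 : 3 / (2 * π) * (TH * p) ≤ 1 / 2 * (12 / π * TH * q) := by
    have := mul_le_mul_of_nonneg_left hth' (by positivity : 0 ≤ 3 / (2 * π) * TH)
    calc 3 / (2 * π) * (TH * p) = 3 / (2 * π) * TH * p := by ring
      _ ≤ 3 / (2 * π) * TH * (4 * q) := this
      _ = 1 / 2 * (12 / π * TH * q) := by ring
  have h3 : 3 / (2 * π) * (TR * (2 * p)) ≤ 1 / 2 * (12 / π * (2 * TR) * q) := by
    have := mul_le_mul_of_nonneg_left hth' (by positivity : 0 ≤ 3 / (2 * π) * TR * 2)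
    calc 3 / (2 * π) * (TR * (2 * p)) = 3 / (2 * π) * TR * 2 * p := by ring
      _ ≤ 3 / (2 * π) * TR * 2 * (4 * q) := this
      _ = 1 / 2 * (12 / π * (2 * TR) * q) := by ring
  have hsplit : 3 / (2 * π) * (ZS * klScale klE0 (n + 1) + TH * p + TR * (2 * p)) =
      3 / (2 * π) * (ZS * klScale klE0 (n + 1)) + 3 / (2 * π) * (TH * p) + 3 / (2 * π) * (TR * (2 * p)) := by ring
  rw [hsplit, h1]
  have e12 : 12 / π * (TH + 2 * TR) * q = 12 / π * TH * q + 12 / π * (2 * TR) * q := by ring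
  rw [e12]
  linarith

/-! ## §2 The `TC` rows at zero transfer -/

omit [NeZero M] in
/-- **The `TC` pinned row at ZERO transfer** (`δ = 0`: direct row at `x = y`): `2·(Λₙ−Λₙ₊₁)·Row^TC_{n+2}(0) ≤ (3/π)·ZS⋆·klE0·(4ⁿ⁺¹)⁻¹ + (12/π)·TH⋆·(4^{n_β−n})⁻¹ + 2·LAT⋆/L`. -/
theorem pinned_row_le_slots_zeroTC {d A G A₀ La : ℝ} (hdA : 0 < d - 4 * A) (hA : 0 ≤ A) (hA0 : 0 ≤ A₀) (hLa : 0 ≤ La)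
    (hβ : klBetaMin ≤ β) {n : ℕ} (hn : n ≤ nScales β) :
    2 * ((klScale klE0 n - klScale klE0 (n + 1)) * klmsRowBoundTC d A G A₀ La β n (n + 2) 0 L) ≤
      3 / π * (64 / Real.pi * 8 *
              (Real.pi * Real.sqrt 2 / (d - 4 * A) * (2 * La + 2 * A₀ * (2 / (1 / 10))) / (d - 4 * A) +
                2 * A₀ * (1 / (d - 4 * A) ^ 2 + Real.pi * Real.sqrt 2 * (2 + 4 * A) / (d - 4 * A) ^ 3))) *
          klE0 * ((4 : ℝ) ^ (n + 1))⁻¹ +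
        12 / π * (393216 / Real.pi * (64 * 16 + (2 * (448 / 3 * Real.exp 2) + 8) + 64) * (2 * A₀ * (Real.pi * Real.sqrt 2 / (d - 4 * A)))) *
          ((4 : ℝ) ^ (nScales β - n))⁻¹ +
        2 * ((96 * (512 * La / klScale klE0 (n + 1) +
            32 * A₀ * G * ((9 * (2 * (448 / 3 * Real.exp 2) + 8) + 4 * 8) + (3 * (8 * (16 : ℝ)) + 512 * 1)) /
              klScale klE0 (n + 1) ^ 2)) / L) := by
  have hπ := Real.pi_pos
  have hβ0 : 0 < β := lt_of_lt_of_le (by norm_num [klBetaMin]) hβ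
  have hΛ1 := klth_klScale_pos (n + 1)
  rw [pinned_rowBound_readingTC]
  set ZS : ℝ := 64 / Real.pi * 8 *
      (Real.pi * Real.sqrt 2 / (d - 4 * A) * (2 * La + 2 * A₀ * (2 / (1 / 10))) / (d - 4 * A) +
                2 * A₀ * (1 / (d - 4 * A) ^ 2 + Real.pi * Real.sqrt 2 * (2 + 4 * A) / (d - 4 * A) ^ 3)) with hZS
  set TH : ℝ := (393216 / Real.pi * (64 * 16 + (2 * (448 / 3 * Real.exp 2) + 8) + 64) * (2 * A₀ * (Real.pi * Real.sqrt 2 / (d - 4 * A)))) with hTH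
  set LAT : ℝ := (96 * (512 * La / klScale klE0 (n + 1) +
            32 * A₀ * G * ((9 * (2 * (448 / 3 * Real.exp 2) + 8) + 4 * 8) + (3 * (8 * (16 : ℝ)) + 512 * 1)) /
              klScale klE0 (n + 1) ^ 2)) with hLAT
  obtain ⟨hZS0, hTH0⟩ : 0 ≤ ZS ∧ 0 ≤ TH := ⟨by rw [hZS]; positivity, by rw [hTH]; positivity⟩
  clear_value ZS TH LAT
  have hΛeq : klScale klE0 (n + 1) = klE0 * ((4 : ℝ) ^ (n + 1))⁻¹ := rfl
  have hth := klmsRoom_thermal_le hβ hn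
  set q : ℝ := ((4 : ℝ) ^ (nScales β - n))⁻¹ with hq
  set p : ℝ := (Real.pi / β) / klScale klE0 (n + 1) with hp
  have hp0 : 0 ≤ p := by rw [hp]; positivity
  have hth' : p ≤ 4 * q := hth
  have hzero : (|(0 : ℝ)| + 0) / klScale klE0 (n + 1) = 0 := by rw [abs_zero, add_zero, zero_div]
  rw [hzero]
  simp only [mul_zero, add_zero]
  have h1 : 3 / (2 * π) * (ZS * klScale klE0 (n + 1)) = 1 / 2 * (3 / π * ZS * klE0 * ((4 : ℝ) ^ (n + 1))⁻¹) := by rw [hΛeq]; ring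
  have h2 : 3 / (2 * π) * (TH * p) ≤ 1 / 2 * (12 / π * TH * q) := by
    have := mul_le_mul_of_nonneg_left hth' (by positivity : 0 ≤ 3 / (2 * π) * TH)
    calc 3 / (2 * π) * (TH * p) = 3 / (2 * π) * TH * p := by ring
      _ ≤ 3 / (2 * π) * TH * (4 * q) := this
      _ = 1 / 2 * (12 / π * TH * q) := by ring
  have hsplit : 3 / (2 * π) * (ZS * klScale klE0 (n + 1) + TH * p) = 3 / (2 * π) * (ZS * klScale klE0 (n + 1)) + 3 / (2 * π) * (TH * p) := by ring
  rw [hsplit, h1]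
  linarith

omit [NeZero M] in
/-- **The `TC` shifted pinned row at ZERO spatial transfer** (`δ = |s| = 2π/β`): `2·(Λₙ−Λₙ₊₁)·Row^TC_{n+2}(|s|) ≤ (3/π)·ZS⋆·klE0·(4ⁿ⁺¹)⁻¹ +
(12/π)·(TH⋆ + 2·TRf⋆ + 8·TRt⋆)·(4^{n_β−n})⁻¹ + 2·LAT⋆/L` (`(π/β)/Λₙ₊₁ ≤ 4·4^{−(n_β−n)} ≤ 4`). -/
theorem pinned_row_le_slots_shift_zeroTC {d A G A₀ La : ℝ} (hdA : 0 < d - 4 * A) (hA : 0 ≤ A) (hA0 : 0 ≤ A₀) (hLa : 0 ≤ La)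
    (hβ : klBetaMin ≤ β) {n : ℕ} (hn : n ≤ nScales β) {s : ℝ} (hs : |s| = 2 * π / β) :
    2 * ((klScale klE0 n - klScale klE0 (n + 1)) * klmsRowBoundTC d A G A₀ La β n (n + 2) |s| L) ≤
      3 / π * (64 / Real.pi * 8 *
              (Real.pi * Real.sqrt 2 / (d - 4 * A) * (2 * La + 2 * A₀ * (2 / (1 / 10))) / (d - 4 * A) +
                2 * A₀ * (1 / (d - 4 * A) ^ 2 + Real.pi * Real.sqrt 2 * (2 + 4 * A) / (d - 4 * A) ^ 3))) *
          klE0 * ((4 : ℝ) ^ (n + 1))⁻¹ +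
        12 / π * ((393216 / Real.pi * (64 * 16 + (2 * (448 / 3 * Real.exp 2) + 8) + 64) * (2 * A₀ * (Real.pi * Real.sqrt 2 / (d - 4 * A)))) +
            2 * (64 / Real.pi * 8 * (2 * A₀ * (Real.pi * Real.sqrt 2 / (d - 4 * A))) * (3 * (8 * (16 : ℝ)) + 512 * 1)) +
            8 * (48 / Real.pi * 8 * (2 * A₀ * (Real.pi * Real.sqrt 2 / (d - 4 * A))) * (3 * (8 * (16 : ℝ)) + 512 * 1))) *
          ((4 : ℝ) ^ (nScales β - n))⁻¹ +
        2 * ((96 * (512 * La / klScale klE0 (n + 1) +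
            32 * A₀ * G * ((9 * (2 * (448 / 3 * Real.exp 2) + 8) + 4 * 8) + (3 * (8 * (16 : ℝ)) + 512 * 1)) /
              klScale klE0 (n + 1) ^ 2)) / L) := by
  have hπ := Real.pi_pos
  have hβ0 : 0 < β := lt_of_lt_of_le (by norm_num [klBetaMin]) hβ
  have hΛ1 := klth_klScale_pos (n + 1)
  rw [pinned_rowBound_readingTC, hs]
  set ZS : ℝ := 64 / Real.pi * 8 *
      (Real.pi * Real.sqrt 2 / (d - 4 * A) * (2 * La + 2 * A₀ * (2 / (1 / 10))) / (d - 4 * A) +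
                2 * A₀ * (1 / (d - 4 * A) ^ 2 + Real.pi * Real.sqrt 2 * (2 + 4 * A) / (d - 4 * A) ^ 3)) with hZS
  set TH : ℝ := (393216 / Real.pi * (64 * 16 + (2 * (448 / 3 * Real.exp 2) + 8) + 64) * (2 * A₀ * (Real.pi * Real.sqrt 2 / (d - 4 * A)))) with hTH
  set TRf : ℝ := (64 / Real.pi * 8 * (2 * A₀ * (Real.pi * Real.sqrt 2 / (d - 4 * A))) * (3 * (8 * (16 : ℝ)) + 512 * 1)) with hTRf
  set TRt : ℝ := (48 / Real.pi * 8 * (2 * A₀ * (Real.pi * Real.sqrt 2 / (d - 4 * A))) * (3 * (8 * (16 : ℝ)) + 512 * 1)) with hTRt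
  set LAT : ℝ := (96 * (512 * La / klScale klE0 (n + 1) +
            32 * A₀ * G * ((9 * (2 * (448 / 3 * Real.exp 2) + 8) + 4 * 8) + (3 * (8 * (16 : ℝ)) + 512 * 1)) /
              klScale klE0 (n + 1) ^ 2)) with hLAT
  obtain ⟨hZS0, hTH0, hTRf0, hTRt0⟩ : 0 ≤ ZS ∧ 0 ≤ TH ∧ 0 ≤ TRf ∧ 0 ≤ TRt :=
    ⟨by rw [hZS]; positivity, by rw [hTH]; positivity, by rw [hTRf]; positivity, by rw [hTRt]; positivity⟩
  clear_value ZS TH TRf TRt LAT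
  have hΛeq : klScale klE0 (n + 1) = klE0 * ((4 : ℝ) ^ (n + 1))⁻¹ := rfl
  have hth := klmsRoom_thermal_le hβ hn
  set q : ℝ := ((4 : ℝ) ^ (nScales β - n))⁻¹ with hq
  set p : ℝ := (Real.pi / β) / klScale klE0 (n + 1) with hp
  have hp0 : 0 ≤ p := by rw [hp]; positivity
  have hth' : p ≤ 4 * q := hth
  have hq1 : q ≤ 1 := by
    rw [hq]; exact inv_le_one_of_one_le₀ (one_le_pow₀ (by norm_num))
  have hp4 : p ≤ 4 := hth'.trans ((mul_le_mul_of_nonneg_left hq1 (by norm_num : (0 : ℝ) ≤ 4)).trans_eq (mul_one 4))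
  have hshift : (|(0 : ℝ)| + 2 * π / β) / klScale klE0 (n + 1) = 2 * p := by
    rw [abs_zero, zero_add, hp]; ring
  rw [hshift]
  have h1 : 3 / (2 * π) * (ZS * klScale klE0 (n + 1)) = 1 / 2 * (3 / π * ZS * klE0 * ((4 : ℝ) ^ (n + 1))⁻¹) := by rw [hΛeq]; ring
  have h2 : 3 / (2 * π) * (TH * p) ≤ 1 / 2 * (12 / π * TH * q) := by
    have := mul_le_mul_of_nonneg_left hth' (by positivity : 0 ≤ 3 / (2 * π) * TH)
    calc 3 / (2 * π) * (TH * p) = 3 / (2 * π) * TH * p := by ring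
      _ ≤ 3 / (2 * π) * TH * (4 * q) := this
      _ = 1 / 2 * (12 / π * TH * q) := by ring
  have h2p : 2 * p ≤ 8 * q := (mul_le_mul_of_nonneg_left hth' (by norm_num : (0 : ℝ) ≤ 2)).trans_eq (by ring)
  have ha : TRf * (2 * p) ≤ TRf * (8 * q) := mul_le_mul_of_nonneg_left h2p hTRf0
  have hb : TRt * p * (2 * p) ≤ TRt * (32 * q) := by
    have h8 : p * (2 * p) ≤ 4 * (2 * p) := mul_le_mul_of_nonneg_right hp4 (by positivity)
    have h32 : 4 * (2 * p) ≤ 32 * q := (mul_le_mul_of_nonneg_left h2p (by norm_num : (0 : ℝ) ≤ 4)).trans_eq (by ring)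
    calc TRt * p * (2 * p) = TRt * (p * (2 * p)) := by ring
      _ ≤ TRt * (32 * q) := mul_le_mul_of_nonneg_left (h8.trans h32) hTRt0
  have h3 : 3 / (2 * π) * ((TRf + TRt * p) * (2 * p)) ≤ 1 / 2 * (12 / π * (2 * TRf + 8 * TRt) * q) := by
    have e : (TRf + TRt * p) * (2 * p) = TRf * (2 * p) + TRt * p * (2 * p) := by ring
    rw [e]
    have := mul_le_mul_of_nonneg_left (add_le_add ha hb) (by positivity : 0 ≤ 3 / (2 * π))
    have e2 : 3 / (2 * π) * (TRf * (8 * q) + TRt * (32 * q)) = 1 / 2 * (12 / π * (2 * TRf + 8 * TRt) * q) := by ring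
    linarith
  have hsplit : 3 / (2 * π) * (ZS * klScale klE0 (n + 1) + TH * p + (TRf + TRt * p) * (2 * p)) =
      3 / (2 * π) * (ZS * klScale klE0 (n + 1)) + 3 / (2 * π) * (TH * p) + 3 / (2 * π) * ((TRf + TRt * p) * (2 * p)) := by ring
  rw [hsplit, h1]
  have e12 : 12 / π * (TH + 2 * TRf + 8 * TRt) * q = 12 / π * TH * q + 12 / π * (2 * TRf + 8 * TRt) * q := by ring
  rw [e12]
  linarith

end Summit.HubbardSuperconductivity.HubbardSuperconductivity.Theorems.KLRegimeSplit

end
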